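import Summits.BirchSwinnertonDyer.BirchSwinnertonDyer.Theorems.ManinLocalTwoThreeShimuraQuotientEisenstein
import Summits.BirchSwinnertonDyer.BirchSwinnertonDyer.Theorems.ManinLocalTwoThreeManinOfStevensConjectures
import Summits.BirchSwinnertonDyer.BirchSwinnertonDyer.Theorems.ManinLocalTwoThreeGammaOneIndexFour
import HarnessLib

/-!
# The Γ₀/Γ₁ transfer reduces to EISENSTEIN optimal curves: E-an-151 ⟸ its Eisenstein-mod-2 sub-law; C2 / C3 from F-need ∧ Stevens I ∧ the Eisenstein sub-laws

Summit `BirchSwinnertonDyer`, route `ManinLocalTwoThree` (cell bsd-f2-manin), cruxes C2 `ManinOddAtFour` (stmt-BirchSwinnertonDyer-22967) and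
C3 `ManinPrimeToThreeAtNine` (stmt-BirchSwinnertonDyer-22968); lead p1 gen 14.  By `…ShimuraQuotientEisenstein` (p719973) a lattice-optimal
`X₀(N)`-datum with `Λ₁(f) ≠ Λ₀(f)` is Eisenstein mod `3` at `9 ∣ N` (`3 ∣ a_p − p − 1` for all primes `p ∤ N`) and Eisenstein mod `2` at
`4 ∣ N`; and `Λ₁ = Λ₀` gives `|c₀| = |c₁|` (`natAbs_maninConstant₀_eq_of_periodLatticeGamma1_eq_periodLattice`).  Hence BY NAME:

* `gammaOneTransferAtFour_of_eisensteinLaw` — **E-an-151 `GammaOneTransferAtFour` ⟸ its EISENSTEIN-mod-2 sub-law** (transfer `|c₀| = |c₁|`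
  demanded only for optimal pairs at `4 ∣ N` whose `X₀`-optimal curve has all `a_p` (`p ∤ N`) even and `Λ₁ ≠ Λ₀`);
* `maninOddAtFour_of_eisensteinLaw` — **C2 ⟸ F-need ∧ C2¹-class (`GammaOneOddOfClassAtFour`, e.g. from Stevens I) ∧ the Eisenstein-mod-2
  sub-law**;
* `natAbs_maninConstant₀_eq_of_eisensteinLaw_nine` / `maninPrimeToThreeAtNine_of_eisensteinLaw` — **C3 ⟸ F-need ∧ Stevens I ∧ the
  Eisenstein-mod-3 sub-law** (transfer at `9 ∣ N` demanded only for pairs whose `X₀`-optimal curve has `a_p ≡ p + 1 (mod 3)` for all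
  `p ∤ N` and `Λ₁ ≠ Λ₀`).

HONEST FRAMING: CONDITIONAL edges; the sub-laws, Stevens I and F-need are OPEN / statement-only; Manin's conjecture, C2, C3 and BSD are NOT
proved.  No definitions, no named facts, no sorry. [cite: LingOesterle1991, Thm. 6] [cite: Stevens1989, Conjectures I–III, §2]
-/

set_option autoImplicit false
-- the summit-side namespace `Summit.BirchSwinnertonDyer.BirchSwinnertonDyer.…` is the tree's (summit = sub-problem)
set_option linter.dupNamespace false

noncomputable section

open scoped Classical
open WeierstrassCurve Literature.NumberTheory.EllipticCurves Literature.NumberTheory.EllipticCurves.ModularForms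
open CongruenceSubgroup
open Summit.BirchSwinnertonDyer.Rank1Residual.ManinAdditive.ShimuraKernel
open Summit.BirchSwinnertonDyer.Rank1Residual.ManinAdditive.KatoCurve
open Summit.BirchSwinnertonDyer.Rank1Residual.ManinConstant

namespace Summit.BirchSwinnertonDyer.BirchSwinnertonDyer.Theorems.ManinLocalTwoThree

/-! ## §1 `p = 2`: E-an-151 and C2 -/

/-- **E-an-151 ⟸ its Eisenstein-mod-2 sub-law.**  If `|c₀| = |c₁|` holds for every optimal pair at `4 ∣ N` whose `X₀`-optimal curve is
Eisenstein mod `2` (`2 ∣ a_p(W₀) − p − 1` for all primes `p ∤ N`) and has `Λ₁(f) ≠ Λ₀(f)`, then E-an-151 `GammaOneTransferAtFour` holds.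
CONDITIONAL edge. [cite: LingOesterle1991, Thm. 6] [cite: Stevens1989, §2] -/
theorem gammaOneTransferAtFour_of_eisensteinLaw
    (hE : ∀ (W₁ W₀ : WeierstrassCurve ℚ) [W₁.IsElliptic] [W₁.IsGloballyMinimal] [W₀.IsElliptic] [W₀.IsGloballyMinimal]
      {N : ℕ} [NeZero N] (D₁ : Gamma1ParametrizationData W₁ N) (D₀ : ModularParametrizationData W₀ N),
      IsIsogenous W₁ W₀ → D₁.IsOptimal → (∀ z ∈ D₀.L.lattice, ∃ w ∈ periodLattice D₀.f, z = D₀.c * w) → 2 ^ 2 ∣ N →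
      (∀ p : ℕ, p.Prime → ¬ p ∣ N → (2 : ℤ) ∣ W₀.LFunction p - p - 1) →
      periodLatticeGamma1 D₀.f ≠ periodLattice D₀.f →
      D₀.maninConstant.natAbs = D₁.maninConstant.natAbs) :
    GammaOneTransferAtFour := by
  intro W₁ W₀ _ _ _ _ N _ D₁ D₀ hiso h₁ h₀ h4
  by_cases hΛ : periodLatticeGamma1 D₀.f = periodLattice D₀.f
  · exact natAbs_maninConstant₀_eq_of_periodLatticeGamma1_eq_periodLattice D₁ D₀ h₁ h₀ (D₁.f_eq_of_isIsogenous D₀ hiso) hΛ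
  · exact hE W₁ W₀ D₁ D₀ hiso h₁ h₀ h4 (fun p hp hpN ↦ two_dvd_lFunction_sub_of_periodLatticeGamma1_ne D₀ h4 hΛ hp hpN) hΛ

/-- **C2 `ManinOddAtFour` ⟸ F-need ∧ C2¹-class ∧ the Eisenstein-mod-2 sub-law of E-an-151** (`body_of_transfer_of_gammaOneOdd`).  The
C2¹-class input `GammaOneOddOfClassAtFour` follows e.g. from Stevens I (`gammaOneOddOfClassAtFour_of_stevensConstantOne`).  CONDITIONAL;
C2 OPEN; BSD not proved. [cite: Stevens1989, Conjectures I–III] [cite: LingOesterle1991, Thm. 6] -/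
theorem maninOddAtFour_of_eisensteinLaw (hex : exists_optimal_gamma1ParametrizationData) (hodd : GammaOneOddOfClassAtFour)
    (hE : ∀ (W₁ W₀ : WeierstrassCurve ℚ) [W₁.IsElliptic] [W₁.IsGloballyMinimal] [W₀.IsElliptic] [W₀.IsGloballyMinimal]
      {N : ℕ} [NeZero N] (D₁ : Gamma1ParametrizationData W₁ N) (D₀ : ModularParametrizationData W₀ N),
      IsIsogenous W₁ W₀ → D₁.IsOptimal → (∀ z ∈ D₀.L.lattice, ∃ w ∈ periodLattice D₀.f, z = D₀.c * w) → 2 ^ 2 ∣ N →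
      (∀ p : ℕ, p.Prime → ¬ p ∣ N → (2 : ℤ) ∣ W₀.LFunction p - p - 1) →
      periodLatticeGamma1 D₀.f ≠ periodLattice D₀.f →
      D₀.maninConstant.natAbs = D₁.maninConstant.natAbs) :
    Summit.BirchSwinnertonDyer.BirchSwinnertonDyer.Theses.ManinLocalTwoThree.ManinOddAtFour :=
  fun _ _ _ _ W _ _ _ _ D hL h4 ↦
    body_of_transfer_of_gammaOneOdd hex (gammaOneTransferAtFour_of_eisensteinLaw hE) hodd W D hL h4

/-! ## §2 `p = 3`: the transfer and C3 -/

/-- **Transfer at `9 ∣ N` ⟸ its Eisenstein-mod-3 sub-law** (per optimal pair): `|c₀| = |c₁|`, provided transfer holds for the pairs whose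
`X₀`-optimal curve is Eisenstein mod `3` (`3 ∣ a_p(W₀) − p − 1`, `p ∤ N`) with `Λ₁ ≠ Λ₀`.  CONDITIONAL edge. [cite: LingOesterle1991, Thm. 6] -/
theorem natAbs_maninConstant₀_eq_of_eisensteinLaw_nine
    (hE : ∀ (W₁ W₀ : WeierstrassCurve ℚ) [W₁.IsElliptic] [W₁.IsGloballyMinimal] [W₀.IsElliptic] [W₀.IsGloballyMinimal]
      {N : ℕ} [NeZero N] (D₁ : Gamma1ParametrizationData W₁ N) (D₀ : ModularParametrizationData W₀ N),
      IsIsogenous W₁ W₀ → D₁.IsOptimal → (∀ z ∈ D₀.L.lattice, ∃ w ∈ periodLattice D₀.f, z = D₀.c * w) → 3 ^ 2 ∣ N →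
      (∀ p : ℕ, p.Prime → ¬ p ∣ N → (3 : ℤ) ∣ W₀.LFunction p - p - 1) →
      periodLatticeGamma1 D₀.f ≠ periodLattice D₀.f →
      D₀.maninConstant.natAbs = D₁.maninConstant.natAbs)
    {W₁ W₀ : WeierstrassCurve ℚ} [W₁.IsElliptic] [W₁.IsGloballyMinimal] [W₀.IsElliptic] [W₀.IsGloballyMinimal]
    {N : ℕ} [NeZero N] (D₁ : Gamma1ParametrizationData W₁ N) (D₀ : ModularParametrizationData W₀ N)
    (hiso : IsIsogenous W₁ W₀) (h₁ : D₁.IsOptimal) (h₀ : ∀ z ∈ D₀.L.lattice, ∃ w ∈ periodLattice D₀.f, z = D₀.c * w)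
    (h9 : 3 ^ 2 ∣ N) : D₀.maninConstant.natAbs = D₁.maninConstant.natAbs := by
  by_cases hΛ : periodLatticeGamma1 D₀.f = periodLattice D₀.f
  · exact natAbs_maninConstant₀_eq_of_periodLatticeGamma1_eq_periodLattice D₁ D₀ h₁ h₀ (D₁.f_eq_of_isIsogenous D₀ hiso) hΛ
  · exact hE W₁ W₀ D₁ D₀ hiso h₁ h₀ h9 (fun p hp hpN ↦ three_dvd_lFunction_sub_of_periodLatticeGamma1_ne D₀ h9 hΛ hp hpN) hΛ

/-- **C3 `ManinPrimeToThreeAtNine` ⟸ F-need ∧ Stevens I ∧ the Eisenstein-mod-3 transfer sub-law.**  (`|c₀| = |c₁| = 1`.)  CONDITIONAL; all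
three inputs OPEN / statement-only; C3 OPEN; BSD not proved. [cite: Stevens1989, Conjectures I–III] [cite: LingOesterle1991, Thm. 6] -/
theorem maninPrimeToThreeAtNine_of_eisensteinLaw (hex : exists_optimal_gamma1ParametrizationData) (hSt1 : StevensConstantOne)
    (hE : ∀ (W₁ W₀ : WeierstrassCurve ℚ) [W₁.IsElliptic] [W₁.IsGloballyMinimal] [W₀.IsElliptic] [W₀.IsGloballyMinimal]
      {N : ℕ} [NeZero N] (D₁ : Gamma1ParametrizationData W₁ N) (D₀ : ModularParametrizationData W₀ N),
      IsIsogenous W₁ W₀ → D₁.IsOptimal → (∀ z ∈ D₀.L.lattice, ∃ w ∈ periodLattice D₀.f, z = D₀.c * w) → 3 ^ 2 ∣ N →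
      (∀ p : ℕ, p.Prime → ¬ p ∣ N → (3 : ℤ) ∣ W₀.LFunction p - p - 1) →
      periodLatticeGamma1 D₀.f ≠ periodLattice D₀.f →
      D₀.maninConstant.natAbs = D₁.maninConstant.natAbs) :
    Summit.BirchSwinnertonDyer.BirchSwinnertonDyer.Theses.ManinLocalTwoThree.ManinPrimeToThreeAtNine := by
  intro _ _ _ _ W₀ _ _ N _ D₀ h₀ h9
  obtain ⟨W₁, _, _, D₁, hiso, h₁⟩ := hex W₀ D₀ h₀
  have heq := natAbs_maninConstant₀_eq_of_eisensteinLaw_nine hE D₁ D₀ hiso h₁ h₀ h9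
  have h1 : |D₁.maninConstant| = 1 := hSt1 W₁ D₁ h₁
  have h1' : D₁.maninConstant.natAbs = 1 := by
    have := Int.abs_eq_natAbs D₁.maninConstant
    rw [h1] at this
    exact_mod_cast this.symm
  intro h3
  have h3' : (3 : ℤ).natAbs ∣ D₀.maninConstant.natAbs := Int.natAbs_dvd_natAbs.mpr h3
  rw [heq, h1'] at h3'
  norm_num at h3'

end Summit.BirchSwinnertonDyer.BirchSwinnertonDyer.Theorems.ManinLocalTwoThree

end
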